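import Summits.ResolutionOfSingularities.ResolutionOfSingularities.Theorems.PurelyInseparableDim4ResConeGoodInvariant
import HarnessLib
import HarnessLib.Audit.Tags

/-!
# Purely inseparable four-folds — THE GOOD TRICHOTOMY OF A BINARY-CONE TAIL, EVERY PRIME `p` AND EVERY SHADE: eventually GOOD, or a
# PERMANENT boundary letter, or at least three boundary letters for ever (K2(p) lane, SLICE C, rung-0 structure for the `(p, d)` tails;
# file-holder res-dim4-p-5 g5)

[OURS · counted 0 · cell `res-dim4-pi` · K2(p) lane, slice C (general-`p` programme) · seat p-5 g5.]  Nothing here proves K2(p) for any `p`,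
`NoIsolatedTrap p p` or resolution of singularities in dimension ≥ 4 / characteristic `p` — NOT proved; a STRUCTURE theorem locating
the residues of the binary-cone tails at every `(p, d)`.  AI kernel work, weaker than expert review.

GOOD(m) := at most two boundary letters at `m` and every boundary pair TT (`…ResConeGoodInvariant`, p710182).  On a witnessed isolated
above-floor `Step0 p` chain with `x^{r₀} ∣ F₀`, constant shade `d` and `e_G ≡ 2` from `k₀`, EXACTLY ONE KIND of future occurs:
* **`good_trichotomy (p)`** — (G) GOOD from some time on (then the tail has an honest pair-confined passive-free partner:
  `pair_representation_of_support_le_two`, p709442 — the TWO-LETTER GAME); or (B) a PERMANENT boundary letter: some `z` with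
  `1 ≤ r_m z`, `z ≠ j m`, `b m z = 0` at every late `m` (never charted, never translated — the B∞ phenomenon of `(5,3)`, res-dim4-p-5 g4's
  located (R-D1) shape); or (T) from some time on there are always at least THREE boundary letters.
  Proof: if ≤ 2-letter times recur and GOOD never settles, GOOD never holds after `k₀` (`good_succ`), and from the first ≤ 2-letter time the
  no-GOOD dynamics (`noGood_step`) keep one letter `z` for ever.
At `d = p − 1` the branches (B) and (T) are empty (`…EventuallyGoodPrime`: the mass `|r|` cannot stop growing); at `d < p − 1` they are the
located residues of slice C(p, d) (e.g. `(5,3)`: (B) = B∞, killed by the Φ-line; res-dim4-p-5 g5's automaton datum 2026-08-29 08:29Z).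
[cite: CossartJannsenSaito2020, Thm. 3.10(4), Thm. 3.14, Thm. 9.3] [cite: HauserPerlega2019PRIMS, §2 (transform D′ of D)]
bears_on: LADDER-RESOLUTION:D157-DOOR2 (res-dim4-pi · K2(p) = `RidgeBudget.NoAboveFloorTrap p p` · slice C(p, d) trichotomy).
Supports stmt-ResolutionOfSingularities-16155 (helper).
-/

set_option linter.dupNamespace false -- mandated namespace of this single-conjunct summit

noncomputable section

namespace Summit.ResolutionOfSingularities.ResolutionOfSingularities.Theorems.PIDim4

namespace ResCone

open MvPolynomial Finset
open Literature.AlgebraicGeometry.Resolution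
open Literature.AlgebraicGeometry.Resolution.CentreBlowup
open Literature.AlgebraicGeometry.Resolution.Hauser2010
open Literature.AlgebraicGeometry.Resolution.HauserPerlega2019

variable {K : Type} [Field K] [DecidableEq K] (p : ℕ) [Fact p.Prime]

/-- **THE GOOD TRICHOTOMY** (every prime `p`, every shade, `e_G ≡ 2`): on a witnessed isolated above-floor `Step0 p` chain with
`x^{r₀} ∣ F₀`, constant shade `d` and `e_G ≡ 2` from `k₀`, either (G) GOOD holds from some time on, or (B) some boundary letter is kept,
with weight `≥ 1`, at every step from some time on, or (T) from some time on every state has at least three boundary letters. [OURS]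
[cite: CossartJannsenSaito2020, Thm. 3.10(4), Thm. 3.14, Thm. 9.3] -/
theorem good_trichotomy {c : ℕ → State K} {j : ℕ → Fin 4} {b : ℕ → Fin 4 → K}
    (hc : ∀ k, IsIsolated p (c k).F ∧ Step0 p (c k) (c (k + 1))) (hw : FreeTail.IsWitnessedChain p c j b)
    (hr0 : ∀ e ∈ (c 0).F.support, (c 0).r ≤ e) (hfloor : ∀ k, ordZero (c k).F ≠ p) {k₀ : ℕ} {d : ℕ∞}
    (hshade : ∀ k, k₀ ≤ k → (c k).shade = d) (he : ∀ k, k₀ ≤ k → Module.finrank K (resVertex (c k)) = 2) :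
    (∃ M, k₀ ≤ M ∧ ∀ m, M ≤ m → ((∃ x y : Fin 4, ∀ i, i ≠ x → i ≠ y → (c m).r i = 0) ∧
        (∀ x y : Fin 4, x ≠ y → 1 ≤ (c m).r x → 1 ≤ (c m).r y →
          ∀ v ∈ resVertex (c m), v x = 0 → v y = 0 → v = 0))) ∨
    (∃ M, k₀ ≤ M ∧ ∃ z : Fin 4, ∀ m, M ≤ m → 1 ≤ (c m).r z ∧ z ≠ j m ∧ b m z = 0) ∨
    (∃ M, k₀ ≤ M ∧ ∀ m, M ≤ m → ¬ ∃ x y : Fin 4, ∀ i, i ≠ x → i ≠ y → (c m).r i = 0) := by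
  have hnew1 := fun m => one_le_succ_r_chart p hc hw hfloor m
  by_cases hT : ∃ M, k₀ ≤ M ∧ ∀ m, M ≤ m → ¬ ∃ x y : Fin 4, ∀ i, i ≠ x → i ≠ y → (c m).r i = 0
  · exact Or.inr (Or.inr hT)
  by_cases hG : ∃ M, k₀ ≤ M ∧ ∀ m, M ≤ m → ((∃ x y : Fin 4, ∀ i, i ≠ x → i ≠ y → (c m).r i = 0) ∧
        (∀ x y : Fin 4, x ≠ y → 1 ≤ (c m).r x → 1 ≤ (c m).r y →
          ∀ v ∈ resVertex (c m), v x = 0 → v y = 0 → v = 0))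
  · exact Or.inl hG
  push Not at hT
  right; left
  -- GOOD never holds after `k₀ + 1` (it would propagate)
  have hbad : ∀ m, k₀ + 1 ≤ m → ¬ ((∃ x y : Fin 4, ∀ i, i ≠ x → i ≠ y → (c m).r i = 0) ∧
        (∀ x y : Fin 4, x ≠ y → 1 ≤ (c m).r x → 1 ≤ (c m).r y →
          ∀ v ∈ resVertex (c m), v x = 0 → v y = 0 → v = 0)) := by
    intro m hm hgood
    apply hG
    refine ⟨m, by omega, fun m' hm' => ?_⟩
    obtain ⟨n, rfl⟩ := Nat.exists_eq_add_of_le hm'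
    clear hm'
    induction n with
    | zero => simpa using hgood
    | succ n ih =>
      obtain ⟨m₀, rfl⟩ : ∃ m₀, m = m₀ + 1 := ⟨m - 1, by omega⟩
      have h := good_succ p hc hw hr0 hfloor hshade he (m := m₀ + n) (by omega)
        (by rw [show m₀ + n + 1 = m₀ + 1 + n by ring]; exact ih.2)
      rw [show m₀ + 1 + (n + 1) = m₀ + n + 2 by ring]
      exact h
  have htwo : ∀ m, k₀ + 1 ≤ m → ∀ x : Fin 4, (∀ i, i ≠ x → (c m).r i = 0) → False := by
    intro m hm x hx
    refine hbad m hm ⟨⟨x, x, fun i hi _ => hx i hi⟩, fun a a' haa' ha ha' => ?_⟩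
    by_cases hax : a = x
    · have := hx a' (by rw [← hax]; exact Ne.symm haa'); omega
    · have := hx a hax; omega
  -- a ≤ 2-letter time `m₀ + 1 ≥ k₀ + 1`
  obtain ⟨m₁, hm₁, x, y, hxy⟩ := hT (k₀ + 1) (by omega)
  obtain ⟨m₀, rfl⟩ : ∃ m₀, m₁ = m₀ + 1 := ⟨m₁ - 1, by omega⟩
  have hjxy : j m₀ = x ∨ j m₀ = y := by
    by_contra hno; push Not at hno
    have := hxy (j m₀) hno.1 hno.2; have := hnew1 m₀; omega
  obtain ⟨z, hzj, hz1, hothers⟩ : ∃ z : Fin 4, z ≠ j m₀ ∧ 1 ≤ (c (m₀ + 1)).r z ∧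
      ∀ i, i ≠ j m₀ → i ≠ z → (c (m₀ + 1)).r i = 0 := by
    have key : ∀ z : Fin 4, (∀ i, i ≠ j m₀ → i ≠ z → (c (m₀ + 1)).r i = 0) →
        ∃ z : Fin 4, z ≠ j m₀ ∧ 1 ≤ (c (m₀ + 1)).r z ∧ ∀ i, i ≠ j m₀ → i ≠ z → (c (m₀ + 1)).r i = 0 := by
      intro z hz
      by_cases hzj : z = j m₀
      · exact (htwo (m₀ + 1) hm₁ (j m₀) fun i hi => hz i hi (by rw [hzj]; exact hi)).elim
      · by_cases hz0 : (c (m₀ + 1)).r z = 0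
        · exact (htwo (m₀ + 1) hm₁ (j m₀) fun i hi => by
            by_cases hiz : i = z
            · rw [hiz]; exact hz0
            · exact hz i hi hiz).elim
        · exact ⟨z, hzj, by omega, hz⟩
    rcases hjxy with h | h
    · exact key y fun i hi hi' => hxy i (by rw [← h]; exact hi) hi'
    · exact key x fun i hi hi' => hxy i hi' (by rw [← h]; exact hi)
  -- the no-GOOD dynamics from `m₀ + 1` on, `z` fixed
  have hP : ∀ n, ((z ≠ j (m₀ + n) ∧ 1 ≤ (c (m₀ + n + 1)).r z ∧
        ∀ i, i ≠ j (m₀ + n) → i ≠ z → (c (m₀ + n + 1)).r i = 0) ∨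
      (∃ a b' : Fin 4, a ≠ b' ∧ a ≠ z ∧ b' ≠ z ∧ 1 ≤ (c (m₀ + n + 1)).r a ∧ 1 ≤ (c (m₀ + n + 1)).r b' ∧
        1 ≤ (c (m₀ + n + 1)).r z ∧ (∀ i, i ≠ a → i ≠ b' → i ≠ z → (c (m₀ + n + 1)).r i = 0) ∧
        ∀ v ∈ resVertex (c (m₀ + n + 1)), v a = 0 → v b' = 0 → v = 0)) := by
    intro n
    induction n with
    | zero => exact Or.inl ⟨by simpa using hzj, by simpa using hz1, by simpa using hothers⟩
    | succ n ih =>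
      have h := (noGood_step p hc hw hr0 hfloor hshade he (m := m₀ + n) (by omega) ih (hbad _ (by omega))
        (hbad _ (by omega))).2
      rw [show m₀ + (n + 1) = m₀ + n + 1 by ring]
      exact h
  have hkept : ∀ n, z ≠ j (m₀ + n + 1) ∧ b (m₀ + n + 1) z = 0 := fun n =>
    (noGood_step p hc hw hr0 hfloor hshade he (m := m₀ + n) (by omega) (hP n) (hbad _ (by omega)) (hbad _ (by omega))).1
  have hz1' : ∀ n, 1 ≤ (c (m₀ + n + 1)).r z := fun n => by
    rcases hP n with ⟨-, h, -⟩ | ⟨_, _, -, -, -, -, -, h, -, -⟩ <;> exact h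
  refine ⟨m₀ + 1, by omega, z, fun m hm => ?_⟩
  obtain ⟨n, rfl⟩ := Nat.exists_eq_add_of_le hm
  rw [show m₀ + 1 + n = m₀ + n + 1 by ring]
  exact ⟨hz1' n, (hkept n).1, (hkept n).2⟩

end ResCone

end Summit.ResolutionOfSingularities.ResolutionOfSingularities.Theorems.PIDim4

end
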